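import Summits.ResolutionOfSingularities.ResolutionOfSingularities.Theorems.PinchTowerShape

/-!
# PinchTower (P5/8) — the TWO CHARTS of the blow-up of a pinch shape in its Σ-stalk `(z, u)` (`n ≤ a`)

Node «PinchTower» of `decomp-res-lens-2` (g31), see `Theorems/MaxContactCutPinchTower.lean`.

For a pinch shape `zⁿ + uᵃ λvᵏ + g`, `a = n + a'`, blown up in `(z, u)`, at a point `x'` of the blow-up (local ring
`S = B_𝔴` of a Rees chart `B`, `σ : A → S`), with `J' = (J S : tⁿ)` the controlled transform:
* §R `exists_sub_mem_of_chartGen_mem` — at the ORIGIN of a chart (all `e_j ∈ 𝔴`) `κ(A) → κ(S)` is onto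
  (`B = A[e_j]`), so `IsConePower` reflects (`isConePower_reflect`); `chart_fibre` — if `χ b₀ + t·r ∈ 𝔪_Sⁿ` then
  `s·Φ(b₀) ∈ 𝔫ⁿ` in the fibre ring `κ(A)[X]` for some `s ∉ 𝔫` (`exists_fibreMap` + `exists_mul_mem_pow_fibre`);
* §Z `PinchShape.zChart` — `J' = (1)`, except at `a = n`, `k = 0` where `J' ⊄ 𝔪_Sⁿ` (the fibre form `1 + λ̄ Xⁿ` would
  lie in `s⁻¹𝔫ⁿ`, forcing `λ̄` to be a cone power: `isConePower_of_mul_mem_pow'`);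
* §U `PinchShape.uChart` — off the origin the same dichotomy (fibre form `Xⁿ + λ̄`), AT the origin a pinch shape with
  `a'` in place of `a` (`z' = e₀`, `u' = t`, `v' = σ v`, `λ' = σ λ`; the tail and `J' ⊆ Q'(n a')` by the chart law
  `map_qWeighted_le_chart` and the colon, the parameters by `isRsopPart_pair/triple_uChart`, the exit condition by
  `a ≡ a' (mod n)` and `isConePower_reflect`).
[cite: Hironaka1964; CossartJannsenSaito2020; CutkoskyBook2004, §7]
-/

open IsLocalRing
open Literature.AlgebraicGeometry.Resolution
open Summit.ResolutionOfSingularities.ResolutionOfSingularities.Theorems.DeltaFaceCutClasses (qWeighted)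
open Summit.ResolutionOfSingularities.ResolutionOfSingularities.Theorems.TowerCut
open Summit.ResolutionOfSingularities.ResolutionOfSingularities.Theorems.PinchCut (IsConePower PinchExitCond)

namespace Summit.ResolutionOfSingularities.ResolutionOfSingularities.Theorems.PinchTower

/-! ## §R  Residue fields at the origin of a chart; the fibre of a chart -/

section Residue

variable {A : Type} [CommRing A] [IsLocalRing A]

/-- **`IsConePower` reflects along a local map with the same residue field.** [folklore] -/
theorem isConePower_reflect {S : Type} [CommRing S] [IsLocalRing S] (σ : A →+* S)
    (hloc : ∀ x : A, σ x ∈ maximalIdeal S ↔ x ∈ maximalIdeal A) (hsurj : ∀ s : S, ∃ a : A, s - σ a ∈ maximalIdeal S)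
    {n : ℕ} {lam : A} (h : IsConePower (ResidueField S) n (residue S (σ lam))) :
    IsConePower (ResidueField A) n (residue A lam) := by
  obtain ⟨α, hα, hbin⟩ := h
  obtain ⟨s, rfl⟩ := IsLocalRing.residue_surjective α
  obtain ⟨a, ha⟩ := hsurj s
  refine ⟨residue A a, ?_, fun i hi hin => ?_⟩
  · rw [← map_pow, ← sub_eq_zero, ← map_sub, IsLocalRing.residue_eq_zero_iff, ← hloc, map_sub, map_pow]
    rw [← map_pow, ← sub_eq_zero, ← map_sub, IsLocalRing.residue_eq_zero_iff] at hα
    have e : σ a ^ n - σ lam = (s ^ n - σ lam) - (s ^ n - σ a ^ n) := by ring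
    rw [e]
    exact Ideal.sub_mem _ hα (Ideal.mem_of_dvd _ (sub_dvd_pow_sub_pow s (σ a) n) ha)
  · have h1 := hbin i hi hin
    rw [← map_natCast (residue S), ← map_natCast σ, IsLocalRing.residue_eq_zero_iff, hloc] at h1
    rw [← map_natCast (residue A), IsLocalRing.residue_eq_zero_iff]
    exact h1

/-- **Residue fields at the origin of a chart**: for the Rees chart `B = A[e_j]` of `c` and a prime `𝔴` of `B` over
`𝔪_A` containing the `e_j` (`j ≠ i`), every element of `S = B_𝔴` is congruent to some `σ a` modulo `𝔪_S`.
[cite: StacksProject, Tag 052P] -/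
theorem exists_sub_mem_of_chartGen_mem (c : Fin 2 → A) (i : Fin 2) (𝔴 : PrimeSpectrum (chartRing c i))
    {S : Type} [CommRing S] [IsLocalRing S] (χ : chartRing c i →+* S)
    (hlocχ : @IsLocalization.AtPrime _ _ S _ χ.toAlgebra 𝔴.asIdeal _)
    (h𝔴 : 𝔴.asIdeal.comap (chartBase c i) = maximalIdeal A)
    (σ : A →+* S) (hσ : ∀ x, χ (chartBase c i x) = σ x) (h0 : ∀ j : Fin 2, j ≠ i → chartGen c i j ∈ 𝔴.asIdeal)
    (s : S) : ∃ a : A, s - σ a ∈ maximalIdeal S := by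
  letI := χ.toAlgebra
  haveI : IsLocalization.AtPrime S 𝔴.asIdeal := hlocχ
  have halg : ∀ b, algebraMap (chartRing c i) S b = χ b := fun b =>
    RingHom.congr_fun (RingHom.algebraMap_toAlgebra χ) b
  have hχ𝔴 : ∀ b, χ b ∈ maximalIdeal S ↔ b ∈ 𝔴.asIdeal := fun b => by
    rw [← halg, IsLocalization.AtPrime.to_map_mem_maximal_iff S 𝔴.asIdeal]
  have hloc : ∀ x : A, σ x ∈ maximalIdeal S ↔ x ∈ maximalIdeal A := fun x => by
    rw [← hσ, hχ𝔴, ← Ideal.mem_comap, h𝔴]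
  -- every element of `B` is `≡ φ a (mod 𝔪_S)`
  have he : ∀ j : {j : Fin 2 // j ≠ i}, residue S (χ (chartGen c i j.1)) = 0 := fun j =>
    (IsLocalRing.residue_eq_zero_iff _).mpr ((hχ𝔴 _).mpr (h0 j.1 j.2))
  have key : ∀ b : chartRing c i, ∃ a : A, χ b - σ a ∈ maximalIdeal S := by
    intro b
    obtain ⟨F, rfl⟩ := eval₂Hom_chartGen_surjective c i b
    refine ⟨MvPolynomial.constantCoeff F, ?_⟩
    rw [← IsLocalRing.residue_eq_zero_iff, map_sub, sub_eq_zero, ← hσ]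
    have h2 := MvPolynomial.map_eval₂Hom (chartBase c i) (fun j : {j : Fin 2 // j ≠ i} => chartGen c i j.1)
      ((residue S).comp χ) F
    simp only [RingHom.comp_apply, he] at h2
    rw [h2, MvPolynomial.eval₂Hom_zero'_apply]
    rfl
  obtain ⟨⟨b, ⟨w, hw⟩⟩, hs⟩ := IsLocalization.surj 𝔴.asIdeal.primeCompl s
  simp only [halg] at hs
  obtain ⟨ab, hab⟩ := key b
  obtain ⟨aw, haw⟩ := key w
  have hwu : χ w ∉ maximalIdeal S := fun h => hw ((hχ𝔴 w).mp h)
  have hawu : aw ∉ maximalIdeal A := fun h => hwu (by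
    have := Ideal.add_mem _ haw ((hloc aw).mpr h)
    simpa using this)
  obtain ⟨υ, rfl⟩ := IsLocalRing.notMem_maximalIdeal.mp hawu
  refine ⟨ab * ↑υ⁻¹, ?_⟩
  have hunitS : IsUnit (σ ↑υ) := (Units.isUnit υ).map σ
  rw [← Ideal.mul_unit_mem_iff_mem _ hunitS]
  have e : (s - σ (ab * ↑υ⁻¹)) * σ ↑υ = s * (σ ↑υ - χ w) + (s * χ w - χ b) + (χ b - σ ab) := by
    rw [map_mul, sub_mul, mul_assoc, ← map_mul, Units.inv_mul, map_one, mul_one]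
    ring
  rw [e]
  refine Ideal.add_mem _ (Ideal.add_mem _ (Ideal.mul_mem_left _ _ ?_) ?_) hab
  · rw [← neg_sub]
    exact neg_mem haw
  · rw [hs, sub_self]
    exact Ideal.zero_mem _

/-- **The fibre of a chart over the closed point**: for a quasi-regular pair `c ⊆ 𝔪_A`, a prime `𝔴` of the Rees chart
`B` over `𝔪_A`, `S = B_𝔴` and `G ∈ A[X]`: if `G(σ, χ e_{i'}) + t·r ∈ 𝔪_Sⁿ` (`t = σ cᵢ`) then, in the fibre ring
`κ(A)[X]` (`Φ : B ↠ κ(A)[X]`, `φ a ↦ ā`, `e_{i'} ↦ X`), `s·Ḡ ∈ 𝔫ⁿ` for the prime `𝔫 = Φ(𝔴)` and some `s ∉ 𝔫`.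
[cite: StacksProject, Tag 0BIQ] -/
theorem chart_fibre (c : Fin 2 → A) (hq : IsQuasiRegular c) (hcm : ∀ j, c j ∈ maximalIdeal A) (i i' : Fin 2)
    (hi : i' ≠ i) (𝔴 : PrimeSpectrum (chartRing c i)) {S : Type} [CommRing S] [IsLocalRing S]
    (χ : chartRing c i →+* S) (hlocχ : @IsLocalization.AtPrime _ _ S _ χ.toAlgebra 𝔴.asIdeal _)
    (h𝔴 : 𝔴.asIdeal.comap (chartBase c i) = maximalIdeal A) (σ : A →+* S)
    (hσ : ∀ x, χ (chartBase c i x) = σ x) (G : Polynomial A) (r : S) {n : ℕ}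
    (hF : G.eval₂ σ (χ (chartGen c i i')) + σ (c i) * r ∈ maximalIdeal S ^ n) :
    ∃ 𝔫 : Ideal (Polynomial (ResidueField A)), 𝔫.IsPrime ∧ ∃ s ∉ 𝔫, s * G.map (residue A) ∈ 𝔫 ^ n := by
  letI := χ.toAlgebra
  haveI : IsLocalization.AtPrime S 𝔴.asIdeal := hlocχ
  have halg : ∀ b, algebraMap (chartRing c i) S b = χ b := fun b =>
    RingHom.congr_fun (RingHom.algebraMap_toAlgebra χ) b
  obtain ⟨Φ, hΦsurj, hΦC, hΦX, hker⟩ := exists_fibreMap c hq hcm i i' hi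
  have hφ𝔴 : ∀ a, a ∈ maximalIdeal A → chartBase c i a ∈ 𝔴.asIdeal := fun a ha => by
    rw [← Ideal.mem_comap, h𝔴]; exact ha
  have hle : Ideal.span {chartBase c i (c i)} ⊔ (maximalIdeal A).map (chartBase c i) ≤ 𝔴.asIdeal := by
    refine sup_le ?_ ?_
    · rw [Ideal.span_singleton_le_iff_mem]
      exact hφ𝔴 _ (hcm i)
    · rw [Ideal.map_le_iff_le_comap, h𝔴]
  have hkerle : ∀ b, Φ b = 0 → b ∈ 𝔴.asIdeal := fun b hb => hle (hker b hb)
  set 𝔫 : Ideal (Polynomial (ResidueField A)) := 𝔴.asIdeal.map Φ with h𝔫def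
  haveI h𝔫 : 𝔫.IsPrime :=
    Ideal.map_isPrime_of_surjective hΦsurj (I := 𝔴.asIdeal) fun b hb => hkerle b (RingHom.mem_ker.mp hb)
  have hΦ𝔴 : ∀ b, b ∈ 𝔴.asIdeal ↔ Φ b ∈ 𝔫 := fun b =>
    ⟨Ideal.mem_map_of_mem Φ, fun h => by
      obtain ⟨x, hx, hxb⟩ := (Ideal.mem_map_iff_of_surjective Φ hΦsurj).mp h
      have h1 := map_sub Φ b x
      rw [hxb, sub_self] at h1
      have h2 := Ideal.add_mem _ (hkerle _ h1) hx
      rwa [sub_add_cancel] at h2⟩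
  have ht : Φ (chartBase c i (c i)) = 0 := by
    rw [hΦC, (IsLocalRing.residue_eq_zero_iff _).mpr (hcm i), map_zero]
  -- the element `b₀ = G(φ, e_{i'})` of `B`
  set b₀ : chartRing c i := G.eval₂ (chartBase c i) (chartGen c i i') with hb₀
  have hχσ : χ.comp (chartBase c i) = σ := RingHom.ext fun x => hσ x
  have hχb₀ : χ b₀ = G.eval₂ σ (χ (chartGen c i i')) := by rw [hb₀, Polynomial.hom_eval₂, hχσ]
  have hΦφ : Φ.comp (chartBase c i) = Polynomial.C.comp (residue A) := RingHom.ext fun x => hΦC x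
  have hΦb₀ : Φ b₀ = G.map (residue A) := by
    rw [hb₀, Polynomial.hom_eval₂, hΦφ, hΦX, ← Polynomial.eval₂_map, Polynomial.eval₂_C_X]
  refine ⟨𝔫, h𝔫, ?_⟩
  rw [← hΦb₀]
  exact exists_mul_mem_pow_fibre 𝔴.asIdeal Φ 𝔫 hΦ𝔴 ht (r := r)
    (F' := G.eval₂ σ (χ (chartGen c i i')) + σ (c i) * r) (by rw [halg, halg, hχb₀, hσ]) hF

end Residue

/-! ## §Z/§U  The two charts -/

section Chart

variable {A : Type} [CommRing A] [IsRegularLocalRing A] {J E : Ideal A} {n a : ℕ}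

/-- At `a = n`, `k = 0` the exit condition says `λ̄` is not a cone power. [folklore] -/
theorem PinchShape.not_isConePower_last (D : PinchShape J E n a) (ha : a = n) (hk : D.k = 0) :
    ¬ IsConePower (ResidueField A) n (residue A D.lam) := by
  rcases D.cond with ⟨h1, -⟩ | ⟨-, h2, -⟩ | ⟨-, -, h3⟩
  · rw [ha, Nat.mod_self] at h1; omega
  · omega
  · exact h3

/-- **The `z`-chart** (`n ≤ a`): `J' = (J S : tⁿ) = (1)` — `h/zⁿ = 1 + t^{a'}e₁ᵃ·σ(λvᵏ) + t·r` is a unit when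
`a > n` or `k ≥ 1` — and at `a = n`, `k = 0`: `J' ⊄ 𝔪_Sⁿ` (else the fibre form `1 + λ̄ Xⁿ` lies in `s⁻¹𝔫ⁿ`,
`isConePower_of_mul_mem_pow'`, against the exit condition). [folklore] -/
theorem PinchShape.zChart (D : PinchShape J E n a) (hn : 1 ≤ n) (hna : n ≤ a) (c : Fin 2 → A)
    (hc : c = ![D.z, D.u]) (𝔴 : PrimeSpectrum (chartRing c 0)) {S : Type} [CommRing S] [IsLocalRing S]
    (χ : chartRing c 0 →+* S) (hlocχ : @IsLocalization.AtPrime _ _ S _ χ.toAlgebra 𝔴.asIdeal _)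
    (h𝔴 : 𝔴.asIdeal.comap (chartBase c 0) = maximalIdeal A)
    (σ : A →+* S) (hσ : ∀ x, χ (chartBase c 0 x) = σ x) :
    Submodule.colon (J.map σ) ((Ideal.span {σ (c 0)} ^ n : Ideal S) : Set S) = ⊤ ∨
      (a = n ∧ ¬ Submodule.colon (J.map σ) ((Ideal.span {σ (c 0)} ^ n : Ideal S) : Set S) ≤ maximalIdeal S ^ n) := by
  letI := χ.toAlgebra
  haveI : IsLocalization.AtPrime S 𝔴.asIdeal := hlocχ
  have halg : ∀ b, algebraMap (chartRing c 0) S b = χ b := fun b =>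
    RingHom.congr_fun (RingHom.algebraMap_toAlgebra χ) b
  have hz0 : c 0 = D.z := by rw [hc]; rfl
  have hu1 : c 1 = D.u := by rw [hc]; rfl
  have hrs : IsRsopPart c := by rw [hc]; exact D.rsop
  set ε : Fin 2 → S := fun l => χ (chartGen c 0 l) with hε
  have hu : ∀ l, σ (c l) = σ (c 0) * ε l := fun l => by
    rw [hε, ← hσ, ← hσ, ← map_mul, ← reesChartBase_apply_eq_mul_chartGen c 0 l]
  have hloc : ∀ x : A, σ x ∈ maximalIdeal S ↔ x ∈ maximalIdeal A := fun x => by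
    rw [← hσ, ← halg, IsLocalization.AtPrime.to_map_mem_maximal_iff S 𝔴.asIdeal, ← Ideal.mem_comap, h𝔴]
  set t := σ (c 0) with ht
  have htm : t ∈ maximalIdeal S := (hloc _).mpr (hz0 ▸ D.z_mem)
  obtain ⟨a', ha'⟩ : ∃ a', a = n + a' := ⟨a - n, by omega⟩
  -- `σ g ∈ (t^{n+1})`
  have hgP : D.g ∈ Ideal.span (Set.range c) ^ (n + 1) :=
    qWeighted_le_pow_of_lt c hna (N := n) (l := n * a + 1) (by omega) (by rw [hc]; exact D.tail)
  have hσg : σ D.g ∈ Ideal.span {t ^ (n + 1)} := by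
    have h := Ideal.mem_map_of_mem σ hgP
    rwa [Ideal.map_pow, Ideal.map_span_range_eq_span_singleton σ c 0 ε hu, Ideal.span_singleton_pow] at h
  obtain ⟨r, hr⟩ := Ideal.mem_span_singleton'.mp hσg
  have hσu : σ D.u = t * ε 1 := by rw [← hu1, hu 1]
  have hσz : σ D.z = t := by rw [← hz0]
  have hf' : σ (D.z ^ n + D.u ^ a * (D.lam * D.v ^ D.k) + D.g) =
      t ^ n * (1 + t ^ a' * ε 1 ^ a * (σ D.lam * σ D.v ^ D.k) + t * r) := by
    simp only [map_add, map_mul, map_pow, hσu, hσz, ← hr, ha']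
    ring
  have hmem := mem_colon_of_map_eq σ D.mem hf'
  by_cases hcase : 1 ≤ a' ∨ D.k ≠ 0
  · -- the cofactor is a unit
    left
    refine Ideal.eq_top_of_isUnit_mem _ hmem ?_
    rw [add_assoc]
    refine isUnit_add_of_mem isUnit_one (Ideal.add_mem _ ?_ (Ideal.mul_mem_right _ _ htm))
    rcases hcase with h1 | h1
    · obtain ⟨a'', rfl⟩ : ∃ a'', a' = a'' + 1 := ⟨a' - 1, by omega⟩
      rw [pow_succ, mul_assoc, mul_assoc]
      exact Ideal.mul_mem_left _ _ (Ideal.mul_mem_right _ _ htm)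
    · have h := (hloc (D.lam * D.v ^ D.k)).mpr (D.lam_mul_v_pow_mem h1)
      rw [map_mul, map_pow] at h
      exact Ideal.mul_mem_left _ _ h
  · -- `a = n`, `k = 0`: the fibre form `1 + λ̄ Xⁿ`
    right
    push Not at hcase
    obtain ⟨ha'0, hk0⟩ := hcase
    have ha0 : a' = 0 := by omega
    refine ⟨by omega, fun hle => D.not_isConePower_last (by omega) hk0 ?_⟩
    have hF : (Polynomial.C D.lam * Polynomial.X ^ n + 1 : Polynomial A).eval₂ σ (χ (chartGen c 0 1)) + t * r ∈
        maximalIdeal S ^ n := by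
      have e : (Polynomial.C D.lam * Polynomial.X ^ n + 1 : Polynomial A).eval₂ σ (χ (chartGen c 0 1)) + t * r =
          1 + t ^ a' * ε 1 ^ a * (σ D.lam * σ D.v ^ D.k) + t * r := by
        rw [Polynomial.eval₂_add, Polynomial.eval₂_mul, Polynomial.eval₂_C, Polynomial.eval₂_pow,
          Polynomial.eval₂_X, Polynomial.eval₂_one, hk0]
        simp only [hε, ha', ha0, pow_zero, add_zero, one_mul, mul_one]
        ring
      rw [e]
      exact hle hmem
    obtain ⟨𝔫, h𝔫, s, hs, hsn⟩ :=
      chart_fibre c hrs.isQuasiRegular (fun j => by rw [hc]; fin_cases j; exacts [D.z_mem, D.u_mem]) 0 1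
        (by decide) 𝔴 χ hlocχ h𝔴 σ hσ _ r hF
    haveI := h𝔫
    rw [Polynomial.map_add, Polynomial.map_mul, Polynomial.map_C, Polynomial.map_pow, Polynomial.map_X,
      Polynomial.map_one] at hsn
    exact isConePower_of_mul_mem_pow' hn D.residue_lam_ne_zero 𝔫 hs hsn

/-- **The `u`-chart** (`n ≤ a`, `a = n + a'`): off the origin `J' = (1)` — `h/uⁿ = e₀ⁿ + t^{a'}σ(λvᵏ) + t·r` — except
at `a = n`, `k = 0` where `J' ⊄ 𝔪_Sⁿ` (fibre form `Xⁿ + λ̄`, `isConePower_of_mul_mem_pow`); AT the origin `e₀ ∈ 𝔴`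
a pinch shape with `a'`: `z' = e₀`, `u' = t`, `v' = σ v`, `λ' = σ λ`. [folklore] -/
theorem PinchShape.uChart (D : PinchShape J E n a) (hn : 1 ≤ n) (hna : n ≤ a) (c : Fin 2 → A)
    (hc : c = ![D.z, D.u]) (𝔴 : PrimeSpectrum (chartRing c 1)) {S : Type} [CommRing S] [IsLocalRing S]
    (χ : chartRing c 1 →+* S) (hlocχ : @IsLocalization.AtPrime _ _ S _ χ.toAlgebra 𝔴.asIdeal _)
    (h𝔴 : 𝔴.asIdeal.comap (chartBase c 1) = maximalIdeal A)
    (σ : A →+* S) (hσ : ∀ x, χ (chartBase c 1 x) = σ x) :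
    (Submodule.colon (J.map σ) ((Ideal.span {σ (c 1)} ^ n : Ideal S) : Set S) = ⊤ ∨
      (a = n ∧ ¬ Submodule.colon (J.map σ) ((Ideal.span {σ (c 1)} ^ n : Ideal S) : Set S) ≤ maximalIdeal S ^ n)) ∨
      Nonempty (PinchShape (Submodule.colon (J.map σ) ((Ideal.span {σ (c 1)} ^ n : Ideal S) : Set S))
        (Ideal.span {σ (c 1)}) n (a - n)) := by
  letI := χ.toAlgebra
  haveI : IsLocalization.AtPrime S 𝔴.asIdeal := hlocχ
  have halg : ∀ b, algebraMap (chartRing c 1) S b = χ b := fun b =>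
    RingHom.congr_fun (RingHom.algebraMap_toAlgebra χ) b
  have hz0 : c 0 = D.z := by rw [hc]; rfl
  have hu1 : c 1 = D.u := by rw [hc]; rfl
  have hrs : IsRsopPart c := by rw [hc]; exact D.rsop
  have hcm : ∀ j, c j ∈ maximalIdeal A := fun j => by rw [hc]; fin_cases j; exacts [D.z_mem, D.u_mem]
  set ε : Fin 2 → S := fun l => χ (chartGen c 1 l) with hε
  have hu : ∀ l, σ (c l) = σ (c 1) * ε l := fun l => by
    rw [hε, ← hσ, ← hσ, ← map_mul, ← reesChartBase_apply_eq_mul_chartGen c 1 l]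
  have hloc : ∀ x : A, σ x ∈ maximalIdeal S ↔ x ∈ maximalIdeal A := fun x => by
    rw [← hσ, ← halg, IsLocalization.AtPrime.to_map_mem_maximal_iff S 𝔴.asIdeal, ← Ideal.mem_comap, h𝔴]
  set t := σ (c 1) with ht
  have htm : t ∈ maximalIdeal S := (hloc _).mpr (hu1 ▸ D.u_mem)
  have hσz : σ D.z = t * ε 0 := by rw [← hz0, hu 0]
  have hσu : σ D.u = t := by rw [← hu1]
  obtain ⟨a', ha'⟩ : ∃ a', a = n + a' := ⟨a - n, by omega⟩
  have han : a - n = a' := by omega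
  rw [han]
  -- the chart law: `J S ⊆ tⁿ · Q'(n a')`, `σ g ∈ tⁿ · Q'(n a' + 1)`
  have hlaw1 := map_qWeighted_le_chart σ c 1 ε hu (a := a) (b := n) (l := n * a) (N := n) hna (by omega) le_rfl
  have hlaw2 := map_qWeighted_le_chart σ c 1 ε hu (a := a) (b := n) (l := n * a + 1) (N := n) hna (by omega)
    (by omega)
  have hl1 : n * a - n * n = n * a' := by rw [ha', Nat.mul_add]; omega
  have hl2 : n * a + 1 - n * n = n * a' + 1 := by rw [ha', Nat.mul_add]; omega
  rw [hl1, han] at hlaw1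
  rw [hl2, han] at hlaw2
  have hdeep : J ≤ qWeighted c a n (n * a) := by rw [hc]; exact D.deep
  have htail : D.g ∈ qWeighted c a n (n * a + 1) := by rw [hc]; exact D.tail
  have hJ' : J.map σ ≤ Ideal.span {t ^ n} * qWeighted ![ε 0, t] a' n (n * a') := (Ideal.map_mono hdeep).trans hlaw1
  obtain ⟨g'', hg'', hg''e⟩ := Ideal.mem_span_singleton_mul.mp (hlaw2 (Ideal.mem_map_of_mem σ htail))
  -- `σ g ∈ (t^{n+1})` as well
  have hgP : D.g ∈ Ideal.span (Set.range c) ^ (n + 1) :=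
    qWeighted_le_pow_of_lt c hna (N := n) (l := n * a + 1) (by omega) htail
  have hσg : σ D.g ∈ Ideal.span {t ^ (n + 1)} := by
    have h := Ideal.mem_map_of_mem σ hgP
    rwa [Ideal.map_pow, Ideal.map_span_range_eq_span_singleton σ c 1 ε hu, Ideal.span_singleton_pow] at h
  obtain ⟨r, hr⟩ := Ideal.mem_span_singleton'.mp hσg
  by_cases h0 : chartGen c 1 0 ∈ 𝔴.asIdeal
  · -- AT THE ORIGIN: pinch shape data with `a'`
    right
    have hrsop2 : IsRsopPart ![ε 0, t] := by
      obtain ⟨e, y, hd, hy⟩ := exists_append_of_isRsopPart hrs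
      have h := isRsopPart_pair_uChart c y hy hd 𝔴 S h𝔴 h0
      simpa only [halg, hσ, hε, ht] using h
    have hrsop3 : D.k = 0 ∨ IsRsopPart ![ε 0, t, σ D.v] := by
      rcases D.vk with hk | hzuv
      · exact Or.inl hk
      · right
        obtain ⟨e, y, hd, hy⟩ := exists_append_of_isRsopPart hzuv
        have hy' : Ideal.span (Set.range (Fin.append c (Fin.append ![D.v] y))) = maximalIdeal A := by
          rw [← hy]
          simp only [range_fin_append, hc, Matrix.range_cons, Matrix.range_empty, Set.union_empty,
            Set.union_assoc]
        have hd' : (maximalIdeal A).spanFinrank = 2 + (1 + e) := by rw [hd]; ring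
        have h := isRsopPart_triple_uChart c (Fin.append ![D.v] y) (Fin.castAdd e 0) hy' hd' 𝔴 S h𝔴 h0
        simpa only [halg, hσ, hε, ht, Fin.append_left, Matrix.cons_val_zero, Matrix.cons_val_fin_one] using h
    -- residue fields and the exit condition
    have hsurj : ∀ s : S, ∃ x : A, s - σ x ∈ maximalIdeal S :=
      exists_sub_mem_of_chartGen_mem c 1 𝔴 χ hlocχ h𝔴 σ hσ (fun j hj => by
        fin_cases j
        · exact h0
        · exact absurd rfl hj)
    have hmod : a % n = a' % n := by rw [ha', Nat.add_mod_left]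
    have hcond : PinchExitCond (ResidueField S) n D.k a' (residue S (σ D.lam)) := by
      rcases D.cond with ⟨h1, h2⟩ | ⟨h1, h2, h3⟩ | ⟨h1, h2, h3⟩
      · rw [hmod] at h1 h2; exact Or.inl ⟨h1, h2⟩
      · rw [hmod] at h1; exact Or.inr (Or.inl ⟨h1, h2, h3⟩)
      · rw [hmod] at h1
        exact Or.inr (Or.inr ⟨h1, h2, fun hcS => h3 (isConePower_reflect σ hloc hsurj hcS)⟩)
    -- `t` is a non-zero-divisor of the regular local ring `S`
    haveI : IsRegularLocalRing S := hrsop2.isRegularLocalRing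
    haveI := isDomain_of_isRegularLocalRing S
    have ht0 : t ∈ nonZeroDivisors S := mem_nonZeroDivisors_of_ne_zero (hrsop2.ne_zero 1)
    have hf' : σ (D.z ^ n + D.u ^ a * (D.lam * D.v ^ D.k) + D.g) =
        t ^ n * (ε 0 ^ n + t ^ a' * (σ D.lam * σ D.v ^ D.k) + g'') := by
      simp only [map_add, map_mul, map_pow, hσz, hσu, ← hg''e, ha']
      ring
    exact ⟨{ z := ε 0
             u := t
             v := σ D.v
             lam := σ D.lam
             g := g''
             k := D.k
             rsop := hrsop2
             vk := hrsop3
             unit := D.unit.map σ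
             exc := rfl
             mem := mem_colon_of_map_eq σ D.mem hf'
             tail := hg''
             deep := colon_le_of_le_span_pow_mul ht0 hJ'
             cond := hcond }⟩
  · -- OFF THE ORIGIN: `e₀` is a unit
    left
    have hunit : IsUnit (ε 0) := by
      rw [hε]; dsimp only; rw [← halg]
      exact IsLocalization.map_units S (⟨chartGen c 1 0, h0⟩ : 𝔴.asIdeal.primeCompl)
    have hf' : σ (D.z ^ n + D.u ^ a * (D.lam * D.v ^ D.k) + D.g) =
        t ^ n * (ε 0 ^ n + t ^ a' * (σ D.lam * σ D.v ^ D.k) + t * r) := by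
      simp only [map_add, map_mul, map_pow, hσz, hσu, ← hr, ha']
      ring
    have hmem := mem_colon_of_map_eq σ D.mem hf'
    by_cases hcase : 1 ≤ a' ∨ D.k ≠ 0
    · left
      refine Ideal.eq_top_of_isUnit_mem _ hmem ?_
      rw [add_assoc]
      refine isUnit_add_of_mem (hunit.pow n) (Ideal.add_mem _ ?_ (Ideal.mul_mem_right _ _ htm))
      rcases hcase with h1 | h1
      · obtain ⟨a'', rfl⟩ : ∃ a'', a' = a'' + 1 := ⟨a' - 1, by omega⟩
        rw [pow_succ, mul_assoc]
        exact Ideal.mul_mem_left _ _ (Ideal.mul_mem_right _ _ htm)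
      · have h := (hloc (D.lam * D.v ^ D.k)).mpr (D.lam_mul_v_pow_mem h1)
        rw [map_mul, map_pow] at h
        exact Ideal.mul_mem_left _ _ h
    · -- `a = n`, `k = 0`: the fibre form `Xⁿ + λ̄`
      right
      push Not at hcase
      obtain ⟨ha'0, hk0⟩ := hcase
      have ha0 : a' = 0 := by omega
      refine ⟨by omega, fun hle => D.not_isConePower_last (by omega) hk0 ?_⟩
      have hF : (Polynomial.X ^ n + Polynomial.C D.lam : Polynomial A).eval₂ σ (χ (chartGen c 1 0)) + t * r ∈
          maximalIdeal S ^ n := by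
        have e : (Polynomial.X ^ n + Polynomial.C D.lam : Polynomial A).eval₂ σ (χ (chartGen c 1 0)) + t * r =
            ε 0 ^ n + t ^ a' * (σ D.lam * σ D.v ^ D.k) + t * r := by
          rw [Polynomial.eval₂_add, Polynomial.eval₂_C, Polynomial.eval₂_pow, Polynomial.eval₂_X, hk0]
          simp only [hε, ha0, pow_zero, one_mul, mul_one]
        rw [e]
        exact hle hmem
      obtain ⟨𝔫, h𝔫, s, hs, hsn⟩ :=
        chart_fibre c hrs.isQuasiRegular hcm 1 0 (by decide) 𝔴 χ hlocχ h𝔴 σ hσ _ r hF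
      haveI := h𝔫
      rw [Polynomial.map_add, Polynomial.map_pow, Polynomial.map_X, Polynomial.map_C] at hsn
      exact isConePower_of_mul_mem_pow hn D.residue_lam_ne_zero 𝔫 hs hsn

end Chart

end Summit.ResolutionOfSingularities.ResolutionOfSingularities.Theorems.PinchTower
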